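import Summits.ValiantsHypothesis.ValiantsHypothesis.Theorems.BarrierLeverAnchoredDoorHitsLowerPairsStarSpec

/-!
# Support item `AnchoredDoorHitsLowerPairs` (stmt-ValiantsHypothesis-22510), line `anchored-peeling`:
# the registered stub `stub_starStep` (THE STAR STEP) — proved

Registered stub `stub_starStep` (signature `Stmt.stub_starStep`) of the v3 skeleton
`Cruxes/AnchoredDoorHitsLowerPairs/Lines/anchored_peeling.lean` (planner valiant-natproofs-p1 g19, D-0145; lane val-np-p1; «SUB-STUB A»
of HOME/val-np-p1/g14/STUBS-v3-anchored-peeling.md, paper proof = ANCHORED-MEMO-valnp1-g14.md §3/§6.1 «Lemma 1𝔄»). Cell valiant-natproofs,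
rung V4, 𝒟-side door (c); prover seat val-np-p1 gen 15. Definition-free; `--supports stmt-ValiantsHypothesis-22510`.

STATEMENT (informal). Faces `Z` (x-side) and `W` (y-side), one of them of size `≤ s`, with equal star counts
`#{i : Z ⊆ u i} = #{j : W ⊆ w j}`: if the symbolic minor of (every enumeration of) the DELETION pair `({S ∈ R : Z ⊄ S}, {T ∈ C : W ⊄ T})`
and of the LINK pair `({S ∖ Z : S ⊇ Z}, {T ∖ W : T ⊇ W})` is a nonzero polynomial in the parameters of the anchored door 𝔄_s, so is the
symbolic minor of `(u, w)`.

PROOF (kernel). (1) ALIGN: permute the columns so that `Z ⊆ u i ↔ W ⊆ w i` (`exists_align`; the sign does not matter,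
`symbolicDet_ne_zero_of_perm`). (2) The two diagonal blocks of the aligned layout are, up to a simultaneous re-enumeration
(`Matrix.det_submatrix_equiv_self`), symbolic minors of injective enumerations of the deletion / link pair with exactly the ranges the
stub's hypotheses ask for (`det_deletionBlock_ne_zero`, `det_linkBlock_ne_zero`). (3) SPECIALISE one anchor (`…StarSpec`): for `|W| ≤ s`
take `α⋆ = ({a} | W)`, `a ∈ Z`, send `θ_{α⋆} ↦ T`, `φ_{α⋆ b} ↦ T` (`b ∈ Z ∖ a`), the other twists of `α⋆` to `0`; then a column `T ⊉ W` of
the specialised layout is constant and a column `T ⊇ W` has `T`-degree `≤ |Z|` with top coefficient `[Z ⊆ S] · L°[S ∖ Z, T ∖ W]`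
(`natDegree_entry_le`, `coeff_entry_top`), so the coefficient of `T^{Σ deg}` in the determinant (`coeff_det_of_natDegree_le`) is the
determinant of a block-LOWER-triangular matrix (`Matrix.twoBlockTriangular_det`) whose diagonal blocks are the deletion block and the
link block — there the full and the reduced layouts agree because `α⋆` cannot contribute (`coeff_symbolicWitness_eq_rest`). For
`|Z| ≤ s` symmetrically `α⋆ = (Z | {c})`, row degrees, block-UPPER-triangular (`starStep_caseZ`). Hence `specHom (symbolicDet) ≠ 0`, so
`symbolicDet ≠ 0`. No weights and no unipotent operators are needed (the surplus twists are killed by the specialisation).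

WHAT THIS IS NOT: the content stub `stub_rigidPairs` (star-step-free pairs) stays OPEN; nothing on items 22510 / 19717 themselves, on
crux stmt-ValiantsHypothesis-14610, or on `VP` versus `VNP`.
-/

set_option linter.dupNamespace false

namespace Summit.ValiantsHypothesis.ValiantsHypothesis.Theorems.BarrierLever.AnchoredPeeling

open Finset MvPolynomial
open Summit.ValiantsHypothesis.ValiantsHypothesis.Theorems.BarrierLever.BrickCalculus (pexpo pexpo_def pexpo_le_iff pexpo_sub)

noncomputable section

/-! ## 7. The two diagonal blocks are symbolic minors of the deletion pair and of the link pair -/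

section Blocks

variable {s h r : ℕ} {u w : Fin r → Finset (Fin h)} {Z W : Finset (Fin h)}

/-- The deletion block (rows and columns off the stars) is the symbolic minor of an enumeration of the deletion pair. -/
theorem det_deletionBlock_ne_zero (hu : Function.Injective u) (hw : Function.Injective w)
    (hal : ∀ i, Z ⊆ u i ↔ W ⊆ w i)
    (hdel : ∀ (r₀ : ℕ) (u₀ w₀ : Fin r₀ → Finset (Fin h)), Function.Injective u₀ → Function.Injective w₀ →
      Set.range u₀ = {S | S ∈ Set.range u ∧ ¬ Z ⊆ S} → Set.range w₀ = {T | T ∈ Set.range w ∧ ¬ W ⊆ T} →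
      symbolicDet s h r₀ u₀ w₀ ≠ 0) :
    (Matrix.of fun i j : {i : Fin r // ¬ Z ⊆ u i} =>
      coeff (pexpo (u i.1) (w j.1)) (symbolicWitness s h)).det ≠ 0 := by
  classical
  set e := Fintype.equivFin {i : Fin r // ¬ Z ⊆ u i} with he
  have key := hdel (Fintype.card {i : Fin r // ¬ Z ⊆ u i}) (fun k => u (e.symm k).1) (fun k => w (e.symm k).1)
    (hu.comp (Subtype.val_injective.comp e.symm.injective)) (hw.comp (Subtype.val_injective.comp e.symm.injective))
    ?_ ?_
  · have hsub : symbolicDet s h _ (fun k => u (e.symm k).1) (fun k => w (e.symm k).1) =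
        ((Matrix.of fun i j : {i : Fin r // ¬ Z ⊆ u i} =>
          coeff (pexpo (u i.1) (w j.1)) (symbolicWitness s h)).submatrix e.symm e.symm).det := rfl
    rwa [hsub, Matrix.det_submatrix_equiv_self] at key
  · ext S
    constructor
    · rintro ⟨k, rfl⟩
      exact ⟨⟨(e.symm k).1, rfl⟩, (e.symm k).2⟩
    · rintro ⟨⟨i, rfl⟩, hi⟩
      exact ⟨e ⟨i, hi⟩, by simp only [Equiv.symm_apply_apply]⟩
  · ext T
    constructor
    · rintro ⟨k, rfl⟩
      exact ⟨⟨(e.symm k).1, rfl⟩, fun hW => (e.symm k).2 ((hal _).mpr hW)⟩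
    · rintro ⟨⟨i, rfl⟩, hi⟩
      exact ⟨e ⟨i, fun hZ => hi ((hal i).mp hZ)⟩, by simp only [Equiv.symm_apply_apply]⟩

/-- The link block (rows and columns in the stars, faces read modulo `Z` / `W`) is the symbolic minor of an enumeration of the
link pair. -/
theorem det_linkBlock_ne_zero (hu : Function.Injective u) (hw : Function.Injective w)
    (hal : ∀ i, Z ⊆ u i ↔ W ⊆ w i)
    (hlink : ∀ (r₁ : ℕ) (u₁ w₁ : Fin r₁ → Finset (Fin h)), Function.Injective u₁ → Function.Injective w₁ →
      Set.range u₁ = {S | Disjoint S Z ∧ S ∪ Z ∈ Set.range u} → Set.range w₁ = {T | Disjoint T W ∧ T ∪ W ∈ Set.range w} →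
      symbolicDet s h r₁ u₁ w₁ ≠ 0) :
    (Matrix.of fun i j : {i : Fin r // Z ⊆ u i} =>
      coeff (pexpo (u i.1 \ Z) (w j.1 \ W)) (symbolicWitness s h)).det ≠ 0 := by
  classical
  set e := Fintype.equivFin {i : Fin r // Z ⊆ u i} with he
  have hWi : ∀ x : {i : Fin r // Z ⊆ u i}, W ⊆ w x.1 := fun x => (hal x.1).mp x.2
  have key := hlink (Fintype.card {i : Fin r // Z ⊆ u i}) (fun k => u (e.symm k).1 \ Z) (fun k => w (e.symm k).1 \ W)
    ?_ ?_ ?_ ?_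
  · have hsub : symbolicDet s h _ (fun k => u (e.symm k).1 \ Z) (fun k => w (e.symm k).1 \ W) =
        ((Matrix.of fun i j : {i : Fin r // Z ⊆ u i} =>
          coeff (pexpo (u i.1 \ Z) (w j.1 \ W)) (symbolicWitness s h)).submatrix e.symm e.symm).det := rfl
    rwa [hsub, Matrix.det_submatrix_equiv_self] at key
  · intro k k' hkk
    apply e.symm.injective
    apply Subtype.val_injective
    apply hu
    have hkk' : u (e.symm k).1 \ Z = u (e.symm k').1 \ Z := hkk
    rw [← Finset.sdiff_union_of_subset (e.symm k).2, ← Finset.sdiff_union_of_subset (e.symm k').2, hkk']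
  · intro k k' hkk
    apply e.symm.injective
    apply Subtype.val_injective
    apply hw
    have hkk' : w (e.symm k).1 \ W = w (e.symm k').1 \ W := hkk
    rw [← Finset.sdiff_union_of_subset (hWi (e.symm k)), ← Finset.sdiff_union_of_subset (hWi (e.symm k')), hkk']
  · ext S
    constructor
    · rintro ⟨k, rfl⟩
      refine ⟨Finset.sdiff_disjoint, ⟨(e.symm k).1, ?_⟩⟩
      rw [Finset.sdiff_union_of_subset (e.symm k).2]
    · rintro ⟨hd, ⟨i, hi⟩⟩
      have hZi : Z ⊆ u i := hi ▸ Finset.subset_union_right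
      refine ⟨e ⟨i, hZi⟩, ?_⟩
      show u (e.symm (e ⟨i, hZi⟩)).1 \ Z = S
      rw [Equiv.symm_apply_apply, hi, Finset.union_sdiff_cancel_right hd]
  · ext T
    constructor
    · rintro ⟨k, rfl⟩
      refine ⟨Finset.sdiff_disjoint, ⟨(e.symm k).1, ?_⟩⟩
      rw [Finset.sdiff_union_of_subset (hWi (e.symm k))]
    · rintro ⟨hd, ⟨i, hi⟩⟩
      have hWi' : W ⊆ w i := hi ▸ Finset.subset_union_right
      refine ⟨e ⟨i, (hal i).mpr hWi'⟩, ?_⟩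
      show w (e.symm (e ⟨i, (hal i).mpr hWi'⟩)).1 \ W = T
      rw [Equiv.symm_apply_apply, hi, Finset.union_sdiff_cancel_right hd]

end Blocks

/-! ## 8. The two cases of the star step (aligned form) -/

section Cases

variable {h : ℕ}

/-- The specialised layout matrix is the image of the symbolic layout matrix; so its determinant is the image of the symbolic
minor. -/
theorem det_specLayout (s h r : ℕ) (u w : Fin r → Finset (Fin h)) (αs : Finset (Fin h) × Finset (Fin h))
    (P Q : Finset (Fin h)) :
    (Matrix.of fun i j : Fin r =>
        coeff (pexpo (u i) (w j)) (MvPolynomial.map (specHom αs P Q) (symbolicWitness s h))).det =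
      specHom αs P Q (symbolicDet s h r u w) := by
  have h1 : symbolicDet s h r u w =
      (Matrix.of fun i j : Fin r => coeff (pexpo (u i) (w j)) (symbolicWitness s h)).det := rfl
  have h2 : (Matrix.of fun i j : Fin r =>
      coeff (pexpo (u i) (w j)) (MvPolynomial.map (specHom αs P Q) (symbolicWitness s h))) =
      (specHom αs P Q).mapMatrix (Matrix.of fun i j : Fin r => coeff (pexpo (u i) (w j)) (symbolicWitness s h)) := by
    ext i j
    rw [RingHom.mapMatrix_apply, Matrix.map_apply, Matrix.of_apply, Matrix.of_apply, coeff_map]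
  rw [h1, RingHom.map_det, h2]

/-- **Case `|W| ≤ s`** (anchor `({a} | W)`, `a ∈ Z`, scaled twists on `Z ∖ a`), aligned layout. -/
theorem starStep_caseW (s h r : ℕ) (u w : Fin r → Finset (Fin h)) (Z W : Finset (Fin h)) (a : Fin h) (ha : a ∈ Z)
    (hW1 : 1 ≤ W.card) (hWs : W.card ≤ s) (hal : ∀ i, Z ⊆ u i ↔ W ⊆ w i)
    (hD₀ : (Matrix.of fun i j : {i : Fin r // ¬ Z ⊆ u i} =>
      coeff (pexpo (u i.1) (w j.1)) (symbolicWitness s h)).det ≠ 0)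
    (hD₁ : (Matrix.of fun i j : {i : Fin r // Z ⊆ u i} =>
      coeff (pexpo (u i.1 \ Z) (w j.1 \ W)) (symbolicWitness s h)).det ≠ 0) :
    symbolicDet s h r u w ≠ 0 := by
  classical
  -- the anchor and the scaled twists
  have hs : 1 ≤ s := le_trans hW1 hWs
  have hαs : (({a}, W) : Finset (Fin h) × Finset (Fin h)) ∈ anchors s h := by
    simp only [anchors, Finset.mem_filter, Finset.mem_univ, true_and, Finset.card_singleton]
    exact ⟨le_refl 1, hs, hW1, hWs⟩
  have hP : Z.erase a ⊆ univ \ (({a}, W) : Finset (Fin h) × Finset (Fin h)).1 := by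
    intro b hb
    rw [Finset.mem_sdiff, Finset.mem_singleton]
    exact ⟨Finset.mem_univ _, Finset.ne_of_mem_erase hb⟩
  have hQ : (∅ : Finset (Fin h)) ⊆ univ \ (({a}, W) : Finset (Fin h) × Finset (Fin h)).2 := Finset.empty_subset _
  have hZP : {a} ∪ Z.erase a = Z := by rw [← Finset.insert_eq, Finset.insert_erase ha]
  have hcardP : (Z.erase a).card + 1 = Z.card := Finset.card_erase_add_one ha
  -- the specialised layout matrix (opaque name `L'`)
  obtain ⟨L', hL'⟩ : ∃ L' : Matrix (Fin r) (Fin r) (Polynomial (MvPolynomial (Param h) ℂ)),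
      L' = Matrix.of fun i j : Fin r =>
        coeff (pexpo (u i) (w j)) (MvPolynomial.map (specHom ({a}, W) (Z.erase a) ∅) (symbolicWitness s h)) :=
    ⟨_, rfl⟩
  -- the entries
  have hentry : ∀ i j, L' i j = Polynomial.C (restEntry s h ({a}, W) (u i) (w j)) + ∑ Z'' ∈ (Z.erase a).powerset,
      (if {a} ∪ Z'' ⊆ u i ∧ W ⊆ w j then
        Polynomial.monomial (Z''.card + 1) (restEntry s h ({a}, W) (u i \ ({a} ∪ Z'')) (w j \ W)) else 0) := by
    intro i j
    rw [hL', Matrix.of_apply, coeff_map_specHom_symbolicWitness s h hαs hP hQ]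
    simp only [Finset.powerset_empty, Finset.sum_singleton, Finset.card_empty, add_zero, Finset.union_empty]
  -- columns off the W-star are constant
  have hconst : ∀ i j, ¬ W ⊆ w j → L' i j = Polynomial.C (restEntry s h ({a}, W) (u i) (w j)) := by
    intro i j hj
    rw [hentry, Finset.sum_eq_zero (fun Z'' _ => if_neg (fun h' => hj h'.2)), add_zero]
  -- column degree bounds
  let d : Fin r → ℕ := fun j => if W ⊆ w j then Z.card else 0
  have hdeg : ∀ i j, (L' i j).natDegree ≤ d j := by
    intro i j
    by_cases hj : W ⊆ w j
    · simp only [d, if_pos hj]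
      rw [hentry, ← hcardP]
      apply natDegree_entry_le
    · simp only [d, if_neg hj]
      rw [hconst i j hj, Polynomial.natDegree_C]
  -- the top-coefficient matrix
  have htop : (Matrix.of fun i j => (L' i j).coeff (d j)) =
      Matrix.of fun i j : Fin r => if Z ⊆ u j then (if Z ⊆ u i then restEntry s h ({a}, W) (u i \ Z) (w j \ W) else 0)
        else restEntry s h ({a}, W) (u i) (w j) := by
    ext i j
    rw [Matrix.of_apply, Matrix.of_apply]
    by_cases hj : W ⊆ w j
    · simp only [d, if_pos hj, if_pos ((hal j).mpr hj)]
      rw [hentry, ← hcardP, coeff_entry_top, hZP]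
      simp only [hj, and_true]
    · simp only [d, if_neg hj, if_neg (fun hZ => hj ((hal j).mp hZ))]
      rw [hconst i j hj, Polynomial.coeff_C_zero]
  -- block triangularity and the two blocks
  have hblock := Matrix.twoBlockTriangular_det
    (Matrix.of fun i j : Fin r => if Z ⊆ u j then (if Z ⊆ u i then restEntry s h ({a}, W) (u i \ Z) (w j \ W) else 0)
      else restEntry s h ({a}, W) (u i) (w j))
    (fun i => Z ⊆ u i) (fun i hi j hj => by rw [Matrix.of_apply, if_pos hj, if_neg hi])
  have hB₁ : Matrix.toSquareBlockProp
      (Matrix.of fun i j : Fin r => if Z ⊆ u j then (if Z ⊆ u i then restEntry s h ({a}, W) (u i \ Z) (w j \ W) else 0)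
        else restEntry s h ({a}, W) (u i) (w j))
      (fun i => Z ⊆ u i) =
      Matrix.of fun i j : {i : Fin r // Z ⊆ u i} => coeff (pexpo (u i.1 \ Z) (w j.1 \ W)) (symbolicWitness s h) := by
    funext i j
    simp only [Matrix.toSquareBlockProp_def, Matrix.of_apply, if_pos j.2, if_pos i.2]
    rw [coeff_symbolicWitness_eq_rest s h hαs]
    rintro ⟨haS, -⟩
    exact (Finset.mem_sdiff.mp (haS (Finset.mem_singleton_self a))).2 ha
  have hB₀ : Matrix.toSquareBlockProp
      (Matrix.of fun i j : Fin r => if Z ⊆ u j then (if Z ⊆ u i then restEntry s h ({a}, W) (u i \ Z) (w j \ W) else 0)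
        else restEntry s h ({a}, W) (u i) (w j))
      (fun i => ¬ Z ⊆ u i) =
      Matrix.of fun i j : {i : Fin r // ¬ Z ⊆ u i} => coeff (pexpo (u i.1) (w j.1)) (symbolicWitness s h) := by
    funext i j
    simp only [Matrix.toSquareBlockProp_def, Matrix.of_apply, if_neg j.2]
    rw [coeff_symbolicWitness_eq_rest s h hαs]
    rintro ⟨-, hWT⟩
    exact j.2 ((hal j.1).mpr hWT)
  -- conclusion
  intro hzero
  have hcoeff := coeff_det_of_natDegree_le L' d hdeg
  rw [htop, hblock, hB₁, hB₀, hL', det_specLayout, hzero, map_zero, Polynomial.coeff_zero] at hcoeff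
  exact mul_ne_zero hD₁ hD₀ hcoeff.symm

/-- **Case `|Z| ≤ s`** (anchor `(Z | {c})`, `c ∈ W`, scaled twists on `W ∖ c`), aligned layout. -/
theorem starStep_caseZ (s h r : ℕ) (u w : Fin r → Finset (Fin h)) (Z W : Finset (Fin h)) (c : Fin h) (hc : c ∈ W)
    (hZ1 : 1 ≤ Z.card) (hZs : Z.card ≤ s) (hal : ∀ i, Z ⊆ u i ↔ W ⊆ w i)
    (hD₀ : (Matrix.of fun i j : {i : Fin r // ¬ Z ⊆ u i} =>
      coeff (pexpo (u i.1) (w j.1)) (symbolicWitness s h)).det ≠ 0)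
    (hD₁ : (Matrix.of fun i j : {i : Fin r // Z ⊆ u i} =>
      coeff (pexpo (u i.1 \ Z) (w j.1 \ W)) (symbolicWitness s h)).det ≠ 0) :
    symbolicDet s h r u w ≠ 0 := by
  classical
  have hs : 1 ≤ s := le_trans hZ1 hZs
  have hαs : ((Z, {c}) : Finset (Fin h) × Finset (Fin h)) ∈ anchors s h := by
    simp only [anchors, Finset.mem_filter, Finset.mem_univ, true_and, Finset.card_singleton]
    exact ⟨hZ1, hZs, le_refl 1, hs⟩
  have hP : (∅ : Finset (Fin h)) ⊆ univ \ ((Z, {c}) : Finset (Fin h) × Finset (Fin h)).1 := Finset.empty_subset _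
  have hQ : W.erase c ⊆ univ \ ((Z, {c}) : Finset (Fin h) × Finset (Fin h)).2 := by
    intro d hd
    rw [Finset.mem_sdiff, Finset.mem_singleton]
    exact ⟨Finset.mem_univ _, Finset.ne_of_mem_erase hd⟩
  have hWQ : {c} ∪ W.erase c = W := by rw [← Finset.insert_eq, Finset.insert_erase hc]
  have hcardQ : (W.erase c).card + 1 = W.card := Finset.card_erase_add_one hc
  have hZne : Z.Nonempty := Finset.card_pos.mp hZ1
  obtain ⟨L', hL'⟩ : ∃ L' : Matrix (Fin r) (Fin r) (Polynomial (MvPolynomial (Param h) ℂ)),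
      L' = Matrix.of fun i j : Fin r =>
        coeff (pexpo (u i) (w j)) (MvPolynomial.map (specHom (Z, {c}) ∅ (W.erase c)) (symbolicWitness s h)) :=
    ⟨_, rfl⟩
  have hentry : ∀ i j, L' i j = Polynomial.C (restEntry s h (Z, {c}) (u i) (w j)) + ∑ W'' ∈ (W.erase c).powerset,
      (if Z ⊆ u i ∧ {c} ∪ W'' ⊆ w j then
        Polynomial.monomial (W''.card + 1) (restEntry s h (Z, {c}) (u i \ Z) (w j \ ({c} ∪ W''))) else 0) := by
    intro i j
    rw [hL', Matrix.of_apply, coeff_map_specHom_symbolicWitness s h hαs hP hQ]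
    simp only [Finset.powerset_empty, Finset.sum_singleton, Finset.card_empty, zero_add, Finset.union_empty]
  have hconst : ∀ i j, ¬ Z ⊆ u i → L' i j = Polynomial.C (restEntry s h (Z, {c}) (u i) (w j)) := by
    intro i j hi
    rw [hentry, Finset.sum_eq_zero (fun W'' _ => if_neg (fun h' => hi h'.1)), add_zero]
  let d : Fin r → ℕ := fun i => if Z ⊆ u i then W.card else 0
  have hdeg : ∀ i j, (L' i j).natDegree ≤ d i := by
    intro i j
    by_cases hi : Z ⊆ u i
    · simp only [d, if_pos hi]
      rw [hentry, ← hcardQ]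
      apply natDegree_entry_le
    · simp only [d, if_neg hi]
      rw [hconst i j hi, Polynomial.natDegree_C]
  have htop : (Matrix.of fun i j => (L' i j).coeff (d i)) =
      Matrix.of fun i j : Fin r => if Z ⊆ u i then (if Z ⊆ u j then restEntry s h (Z, {c}) (u i \ Z) (w j \ W) else 0)
        else restEntry s h (Z, {c}) (u i) (w j) := by
    ext i j
    rw [Matrix.of_apply, Matrix.of_apply]
    by_cases hi : Z ⊆ u i
    · simp only [d, if_pos hi]
      rw [hentry, ← hcardQ, coeff_entry_top, hWQ]
      simp only [hi, true_and, hal j]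
    · simp only [d, if_neg hi]
      rw [hconst i j hi, Polynomial.coeff_C_zero]
  have hblock := Matrix.twoBlockTriangular_det'
    (Matrix.of fun i j : Fin r => if Z ⊆ u i then (if Z ⊆ u j then restEntry s h (Z, {c}) (u i \ Z) (w j \ W) else 0)
      else restEntry s h (Z, {c}) (u i) (w j))
    (fun i => Z ⊆ u i) (fun i hi j hj => by rw [Matrix.of_apply, if_pos hi, if_neg hj])
  have hB₁ : Matrix.toSquareBlockProp
      (Matrix.of fun i j : Fin r => if Z ⊆ u i then (if Z ⊆ u j then restEntry s h (Z, {c}) (u i \ Z) (w j \ W) else 0)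
        else restEntry s h (Z, {c}) (u i) (w j))
      (fun i => Z ⊆ u i) =
      Matrix.of fun i j : {i : Fin r // Z ⊆ u i} => coeff (pexpo (u i.1 \ Z) (w j.1 \ W)) (symbolicWitness s h) := by
    funext i j
    simp only [Matrix.toSquareBlockProp_def, Matrix.of_apply, if_pos i.2, if_pos j.2]
    rw [coeff_symbolicWitness_eq_rest s h hαs]
    rintro ⟨hZS, -⟩
    obtain ⟨b, hb⟩ := hZne
    exact (Finset.mem_sdiff.mp (hZS hb)).2 hb
  have hB₀ : Matrix.toSquareBlockProp
      (Matrix.of fun i j : Fin r => if Z ⊆ u i then (if Z ⊆ u j then restEntry s h (Z, {c}) (u i \ Z) (w j \ W) else 0)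
        else restEntry s h (Z, {c}) (u i) (w j))
      (fun i => ¬ Z ⊆ u i) =
      Matrix.of fun i j : {i : Fin r // ¬ Z ⊆ u i} => coeff (pexpo (u i.1) (w j.1)) (symbolicWitness s h) := by
    funext i j
    simp only [Matrix.toSquareBlockProp_def, Matrix.of_apply, if_neg i.2]
    rw [coeff_symbolicWitness_eq_rest s h hαs]
    rintro ⟨hZS, -⟩
    exact i.2 hZS
  intro hzero
  have hcoeff := coeff_det_of_natDegree_le_row L' d hdeg
  rw [htop, hblock, hB₁, hB₀, hL', det_specLayout, hzero, map_zero, Polynomial.coeff_zero] at hcoeff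
  exact mul_ne_zero hD₁ hD₀ hcoeff.symm

end Cases

/-! ## 9. The registered stub -/

/-- **Registered stub `stub_starStep` of line `anchored_peeling` (item 22510).** -/
theorem stub_starStep : Stmt.stub_starStep := by
  intro s h r u w hu hw _ _ Z W _ _ hZ1 hW1 hsmall hcnt hdel hlink
  classical
  obtain ⟨π, hπ⟩ := exists_align u w Z W hcnt
  refine symbolicDet_ne_zero_of_perm s h r u w π ?_
  have hwπ : Function.Injective (w ∘ π) := hw.comp π.injective
  have hrange : Set.range (w ∘ π) = Set.range w := π.surjective.range_comp w
  have hal : ∀ i, Z ⊆ u i ↔ W ⊆ (w ∘ π) i := hπ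
  have hD₀ := det_deletionBlock_ne_zero (s := s) hu hwπ hal (by rw [hrange]; exact hdel)
  have hD₁ := det_linkBlock_ne_zero (s := s) hu hwπ hal (by rw [hrange]; exact hlink)
  rcases hsmall with hZs | hWs
  · obtain ⟨c, hc⟩ : W.Nonempty := Finset.card_pos.mp hW1
    exact starStep_caseZ s h r u (w ∘ π) Z W c hc hZ1 hZs hal hD₀ hD₁
  · obtain ⟨a, ha⟩ : Z.Nonempty := Finset.card_pos.mp hZ1
    exact starStep_caseW s h r u (w ∘ π) Z W a ha hW1 hWs hal hD₀ hD₁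

end

end Summit.ValiantsHypothesis.ValiantsHypothesis.Theorems.BarrierLever.AnchoredPeeling
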